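import Summits.BirchSwinnertonDyer.BirchSwinnertonDyer.Theorems.AdditiveBranchIMCTwistRootNumberGoodKroneckerAnyTwo
import Summits.BirchSwinnertonDyer.BirchSwinnertonDyer.Theorems.AdditiveBranchIMCGordTwoTwistedReciprocityAnyTwo
import Summits.BirchSwinnertonDyer.BirchSwinnertonDyer.Theorems.ManinLocalTwoThreeUnramifiedTwistReduction
import HarnessLib

/-!
# ENGINE₂ of door D: the root number of the DYADIC twist `E = W₁^{(t)}` of a curve `W₁` MULTIPLICATIVE at `2`, `t ∈ {−1, 2, −2}`
# (crux 19357 `GordTwoRankZeroOffCaseOne`, line `three_field_road`, door D «`ℓ₀ = 2`», LeadReport27 §5 item 3 / pen e21 (D3)(b);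
# LEAD cruxlead-19357 g18, `--supports` 19357, groundwork helper only)

Theorems only. On the door-D rows `E` is additive at `2` of twist type and POTENTIALLY MULTIPLICATIVE: `W₁ = E^{(t)}` is multiplicative at `2`, and
`E ≅ W₁^{(t)}`. The field-one supply must compare `w(E)` with `w(E^{(d_K)}) = w(W₁^{(m)})` (`d_K = 4t·m`; the latter is the odd good-prime engine
`rootNumber_quadraticTwist_eq_of_good_kronecker_anyTwo`, p817922, on `W₁`). This file supplies the missing link `w(W₁^{(t)})` against `w(W₁)`:

  `w(W₁^{(t)}) = χ_t(−1) · w₂(W₁) · (∏_{r ∥ N_{W₁}, r odd} (t/r)) · w(W₁)`,  `χ_t(−1) = −1, +1, −1` for `t = −1, 2, −2`,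

`w₂(W₁) = −1` (split) / `+1` (non-split). MODULAR proof (`w = −ε`, `ε = ∏ λ_r`): the prime sets of `N_{W₁}` and `N_E` agree; `λ₂(f_E) = χ_t(−1)`
(LEAD g18 p815990 / g17 p814752: `f₂(E) ∈ {4, 6}`, Atkin–Li); `λ₂(f_{W₁}) = w₂(W₁)` (`2 ∥ N_{W₁}`); at an odd multiplicative `r` the unit twist by `t`
swaps split/non-split iff `(t/r) = −1`; at an odd additive twist-type `r` both signs are `χ₄(r)`.

* `rootNumber_quadraticTwist_dyadic_of_hasMultiplicativeReductionAtPrime_two`.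

BSD is proved for no curve. [AtkinLi1978] §3; [Rohrlich1993Compositio] Prop. 2–3; [SilvermanAEC2009] X.5 Cor. 5.4, Ex. 10.16; [BarriosEtAl2025] Thm. 5.1.
-/

set_option linter.dupNamespace false
set_option autoImplicit false

noncomputable section

open scoped MatrixGroups Classical

open CongruenceSubgroup Literature.NumberTheory.EllipticCurves Literature.NumberTheory.EllipticCurves.ModularForms
  IsDedekindDomain IsDedekindDomain.HeightOneSpectrum NumberField Rat.HeightOneSpectrum WeierstrassCurve
  Summit.BirchSwinnertonDyer.Rank1Residual Summit.BirchSwinnertonDyer.BirchSwinnertonDyer.Theorems NumberTheorySymbols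

namespace Summit.BirchSwinnertonDyer.BirchSwinnertonDyer.Theorems.TwistRootNumberTwisted

variable (W : WeierstrassCurve ℚ) [W.IsElliptic] [W.IsGloballyMinimal]

/-- **ENGINE₂: `w(W₁^{(t)}) = χ_t(−1)·w₂(W₁)·(∏_{r ∥ N₁, r odd}(t/r))·w(W₁)`** for `W₁` (here `W`, globally minimal) MULTIPLICATIVE at `2` with odd
additive primes of twist type and `t ∈ {−1, 2, −2}` (module docstring). [cite: AtkinLi1978, §1 and §3] [cite: Rohrlich1993Compositio, Prop. 2 (ii)–(iii) and Prop. 3]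
[cite: SilvermanAEC2009, Ex. 10.16, App. A Prop. A.1.1 and X.5 Cor. 5.4] [cite: BarriosEtAl2025, Thm. 5.1] -/
theorem rootNumber_quadraticTwist_dyadic_of_hasMultiplicativeReductionAtPrime_two (hmod : exists_isNewformOf)
    (htt : ∀ p : Nat.Primes, (p : ℕ) ≠ 2 → W.HasAdditiveReductionAt ((primesEquiv (R := ℤ)).symm p) →
      ¬ (W.quadraticTwist (((-1 : ℤ) ^ ((p : ℕ) / 2) * p : ℤ) : ℚ)).HasAdditiveReductionAt
        ((primesEquiv (R := ℤ)).symm p))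
    (hm2 : W.HasMultiplicativeReductionAtPrime 2) {t : ℤ} (ht : t = -1 ∨ t = 2 ∨ t = -2) :
    (W.quadraticTwist (t : ℚ)).rootNumber =
      (if t = 2 then 1 else -1) * (if W.HasSplitMultiplicativeReductionAtPrime 2 then -1 else 1) *
        (∏ r ∈ (W.conductorNorm ℤ).primeFactors.erase 2,
          (if (W.conductorNorm ℤ).factorization r = 1 then jacobiSym t r else 1)) *
        W.rootNumber := by
  have ht0 : t ≠ 0 := by rcases ht with rfl | rfl | rfl <;> norm_num
  have htQ : (t : ℚ) ≠ 0 := by exact_mod_cast ht0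
  have htodd : ∀ r : Nat.Primes, (r : ℕ) ≠ 2 → ¬ ((r : ℕ) : ℤ) ∣ t := by
    intro r hr2 h
    have h' : ((r : ℕ) : ℤ) ∣ 2 := by
      rcases ht with rfl | rfl | rfl
      · exact (dvd_neg.mp h).trans (one_dvd _)
      · exact h
      · exact dvd_neg.mp h
    have h2 : (r : ℕ) ∣ 2 := by exact_mod_cast h'
    exact hr2 ((Nat.prime_dvd_prime_iff_eq r.2 Nat.prime_two).mp h2)
  set W' := W.quadraticTwist (t : ℚ) with hW'
  haveI : W'.IsElliptic := W.isElliptic_quadraticTwist htQ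
  set P2 : Nat.Primes := ⟨2, Nat.prime_two⟩ with hP2
  set v₂ : HeightOneSpectrum ℤ := (primesEquiv (R := ℤ)).symm P2 with hv₂
  set N := W.conductorNorm ℤ with hN
  set N' := W'.conductorNorm ℤ with hN'
  have hN0 : N ≠ 0 := (W.conductorNorm_pos_holds).ne'
  have hN'0 : N' ≠ 0 := (W'.conductorNorm_pos_holds).ne'
  haveI : NeZero (W.conductorNorm ℤ) := ⟨hN0⟩
  haveI : NeZero (W'.conductorNorm ℤ) := ⟨hN'0⟩
  -- at `2`: `W` multiplicative (`f₂ = 1`), `W'` additive of twist type with parameter `t` (`W'^{(t)} ≅ W` not additive), `f₂(W') ∈ {4, 6}`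
  have hm2v : W.HasMultiplicativeReductionAt v₂ := (W.hasMultiplicativeReductionAtPrime_iff_hasMultiplicativeReductionAt_holds P2).mp hm2
  obtain ⟨C, hC⟩ := W.exists_variableChange_smul_eq_quadraticTwist_sq (θ := (t : ℚ)) htQ
  have hback : W'.quadraticTwist (t : ℚ) = C • W := by rw [hW', quadraticTwist_quadraticTwist, hC, sq]
  haveI : (W'.quadraticTwist (t : ℚ)).IsElliptic := by rw [hback]; infer_instance
  have hnt : ¬ (W'.quadraticTwist (t : ℚ)).HasAdditiveReductionAt v₂ := by
    intro h
    have h2le := (two_le_conductorExponent_iff_holds v₂ (W'.quadraticTwist (t : ℚ))).mpr h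
    rw [hback, conductorExponent_smul' v₂ W C, (conductorExponent_eq_one_iff_holds v₂ W).mpr hm2v] at h2le
    omega
  have hf2' : W'.conductorExponent v₂ = if t = -1 then 4 else 6 := conductorExponent_two_eq_of_twistType_two W' ht hnt
  have hadd' : W'.HasAdditiveReductionAt v₂ := (two_le_conductorExponent_iff_holds v₂ W').mp (by rw [hf2']; split_ifs <;> omega)
  have hf2 : W.conductorExponent v₂ = 1 := (conductorExponent_eq_one_iff_holds v₂ W).mpr hm2v
  -- at odd `r`: reduction types and conductor exponents agree (`t` is an `r`-adic unit)
  have hred : ∀ r : Nat.Primes, (r : ℕ) ≠ 2 →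
      (W'.HasGoodReductionAt ((primesEquiv (R := ℤ)).symm r) ↔ W.HasGoodReductionAt ((primesEquiv (R := ℤ)).symm r)) ∧
      (W'.HasMultiplicativeReductionAt ((primesEquiv (R := ℤ)).symm r) ↔ W.HasMultiplicativeReductionAt ((primesEquiv (R := ℤ)).symm r)) ∧
      (W'.HasAdditiveReductionAt ((primesEquiv (R := ℤ)).symm r) ↔ W.HasAdditiveReductionAt ((primesEquiv (R := ℤ)).symm r)) :=
    fun r hr2 ↦ W.hasReductionAt_quadraticTwist_iff_of_not_dvd _ (by rw [Rat.natGenerator_primesEquiv_symm]; exact hr2)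
      (by rw [Rat.natGenerator_primesEquiv_symm]; exact htodd r hr2)
  have hfac_eq : ∀ r : Nat.Primes, (r : ℕ) ≠ 2 → N'.factorization r = N.factorization r := fun r hr2 ↦
    ManinLocalTwoThree.factorization_conductorNorm_quadraticTwist_eq_of_not_dvd_odd W r.2 hr2 (htodd r hr2)
  have httW' : ∀ p : Nat.Primes, (p : ℕ) ≠ 2 → W'.HasAdditiveReductionAt ((primesEquiv (R := ℤ)).symm p) →
      ¬ (W'.quadraticTwist (((-1 : ℤ) ^ ((p : ℕ) / 2) * p : ℤ) : ℚ)).HasAdditiveReductionAt ((primesEquiv (R := ℤ)).symm p) := by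
    intro r hr2 ha'
    have ha : W.HasAdditiveReductionAt ((primesEquiv (R := ℤ)).symm r) := ((hred r hr2).2.2).mp ha'
    exact TwistRootNumberAnyTwo.twistType_quadraticTwist_of_not_dvd W htt t r hr2 (by rw [Rat.natGenerator_primesEquiv_symm]; exact htodd r hr2) ha
  have hle := TwistRootNumberAnyTwo.conductorExponent_pStar_le W htt
  have hle' := TwistRootNumberAnyTwo.conductorExponent_pStar_le W' httW'
  have hdvd_iff : ∀ (n : ℕ) (hn : n ≠ 0) (p : Nat.Primes), (p : ℕ) ∣ n ↔ n.factorization p ≠ 0 := fun n hn p ↦ by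
    rw [Ne, Nat.factorization_eq_zero_iff]; push Not; exact ⟨fun h ↦ ⟨p.2, h, hn⟩, fun h ↦ h.2.1⟩
  have h2N : 2 ∣ N := (hdvd_iff N hN0 P2).mpr (by rw [factorization_conductorNorm_primesEquiv_symm W P2, ← hv₂, hf2]; norm_num)
  have h4N : ¬ 2 ^ 2 ∣ N := by
    rw [Nat.prime_two.pow_dvd_iff_le_factorization hN0, show N.factorization 2 = N.factorization P2 from rfl,
      factorization_conductorNorm_primesEquiv_symm W P2, ← hv₂, hf2]; omega
  have h2N' : 2 ∣ N' := (hdvd_iff N' hN'0 P2).mpr (by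
    rw [factorization_conductorNorm_primesEquiv_symm W' P2, ← hv₂, hf2']; split_ifs <;> norm_num)
  -- the prime sets agree
  have hpf : N'.primeFactors = N.primeFactors := by
    ext r
    simp only [Nat.mem_primeFactors]
    constructor
    · rintro ⟨hr, hrN', -⟩
      refine ⟨hr, ?_, hN0⟩
      by_cases hr2 : r = 2
      · rw [hr2]; exact h2N
      · set R : Nat.Primes := ⟨r, hr⟩
        have h := (hdvd_iff N' hN'0 R).mp hrN'
        rw [show N'.factorization R = N'.factorization r from rfl, hfac_eq R hr2] at h
        exact (hdvd_iff N hN0 R).mpr h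
    · rintro ⟨hr, hrN, -⟩
      refine ⟨hr, ?_, hN'0⟩
      by_cases hr2 : r = 2
      · rw [hr2]; exact h2N'
      · set R : Nat.Primes := ⟨r, hr⟩
        have h := (hdvd_iff N hN0 R).mp hrN
        rw [← hfac_eq R hr2] at h
        exact (hdvd_iff N' hN'0 R).mpr h
  have h2mem : 2 ∈ N.primeFactors := Nat.mem_primeFactors.mpr ⟨Nat.prime_two, h2N, hN0⟩
  obtain ⟨f, hf⟩ := hmod W
  obtain ⟨f', hf'⟩ := hmod W'
  have hε := IsNewform0.frickeEigenvalue_eq_prod_atkinLehnerEigenvalueAt_holds hf.1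
  have hε' := IsNewform0.frickeEigenvalue_eq_prod_atkinLehnerEigenvalueAt_holds hf'.1
  -- `λ₂(f') = χ_t(−1)` and `λ₂(f) = w₂(W)`
  have hlam2' : atkinLehnerEigenvalueAt f' 2 = if t = 2 then 1 else -1 :=
    atkinLehnerEigenvalueAt_two_eq_of_twistType_two W' hmod ht hadd' hnt hf' (by rw [hW'])
  have hlam2 : atkinLehnerEigenvalueAt f 2 = ((if W.HasSplitMultiplicativeReductionAtPrime 2 then (-1 : ℤ) else 1 : ℤ) : ℂ) := by
    rw [W.atkinLehnerEigenvalueAt_eq_localRootNumberAt_of_not_sq_dvd hf P2 h2N h4N, localRootNumberAt_primesEquiv_symm_eq]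
    by_cases hs : W.HasSplitMultiplicativeReductionAtPrime 2
    · rw [localRootNumber_of_hasSplitMultiplicativeReduction _ _ hs, if_pos hs]
    · rw [localRootNumber_of_hasMultiplicativeReduction _ _ hm2 hs, if_neg hs]
  set jf : ℕ → ℤ := fun r ↦ if N.factorization r = 1 then jacobiSym t r else 1 with hjf
  have hlam_eq : ∀ r ∈ N.primeFactors.erase 2, atkinLehnerEigenvalueAt f' r = (jf r : ℂ) * atkinLehnerEigenvalueAt f r := by
    intro r hr
    obtain ⟨hr2, hrN⟩ := Finset.mem_erase.mp hr
    obtain ⟨hrp, hrdvd, -⟩ := Nat.mem_primeFactors.mp hrN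
    set R : Nat.Primes := ⟨r, hrp⟩
    haveI := Fact.mk hrp
    have hrD : ¬ ((r : ℕ) : ℤ) ∣ t := htodd R hr2
    have hbad : ¬ W.HasGoodReductionAt ((primesEquiv (R := ℤ)).symm R) := fun hg ↦ ((W.dvd_conductorNorm_iff_not_hasGoodReductionAtPrime r).mp hrdvd)
        ((W.hasGoodReductionAtPrime_iff_hasGoodReductionAt_holds R).mpr hg)
    rcases hasGoodReductionAt_or_hasMultiplicativeReductionAt_or_hasAdditiveReductionAt ((primesEquiv (R := ℤ)).symm R) W with h | hm | ha
    · exact absurd h hbad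
    · -- multiplicative: both are local root numbers; `r` is odd here
      have hf1 : W.conductorExponent ((primesEquiv (R := ℤ)).symm R) = 1 := (conductorExponent_eq_one_iff_holds _ W).mpr hm
      have hf1' : W'.conductorExponent ((primesEquiv (R := ℤ)).symm R) = 1 :=
        (conductorExponent_eq_one_iff_holds _ W').mpr (((hred R hr2).2.1).mpr hm)
      have hfac1 : N.factorization r = 1 := by
        rw [show N.factorization r = N.factorization R from rfl, factorization_conductorNorm_primesEquiv_symm W R, hf1]
      have hrN' : r ∣ N' := (hdvd_iff N' hN'0 R).mpr (by rw [factorization_conductorNorm_primesEquiv_symm W' R, hf1']; norm_num)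
      have hrrN' : ¬ r ^ 2 ∣ N' := by
        rw [hrp.pow_dvd_iff_le_factorization hN'0, show N'.factorization r = N'.factorization R from rfl,
          factorization_conductorNorm_primesEquiv_symm W' R, hf1']; omega
      have hrrN : ¬ r ^ 2 ∣ N := by
        rw [hrp.pow_dvd_iff_le_factorization hN0, show N.factorization r = N.factorization R from rfl,
          factorization_conductorNorm_primesEquiv_symm W R, hf1]; omega
      rw [W'.atkinLehnerEigenvalueAt_eq_localRootNumberAt_of_not_sq_dvd hf' R hrN' hrrN',
        W.atkinLehnerEigenvalueAt_eq_localRootNumberAt_of_not_sq_dvd hf R hrdvd hrrN]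
      simp only [hjf, hfac1, if_true]
      · rcases jacobiSym.eq_one_or_neg_one (a := t) (b := r) (by
            rw [Int.gcd_eq_natAbs, Int.natAbs_natCast]
            exact Nat.Coprime.symm ((Nat.Prime.coprime_iff_not_dvd hrp).mpr fun h ↦ hrD (Int.natCast_dvd.mpr h))) with hj | hj
        · -- square: the curves are isomorphic over `ℚ_r`
          rw [W.localRootNumberAt_quadraticTwist_of_isSquare R ht0 (isSquare_padic_of_jacobiSym_eq_one hr2 hj), hj]
          push_cast; ring
        · -- non-square unit at a multiplicative prime: split and non-split are swapped, the local root number flips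
          obtain ⟨w, hw⟩ : ∃ w : HeightOneSpectrum (𝓞 ℚ), (primesEquiv w : ℕ) = r := ⟨(primesEquiv (R := 𝓞 ℚ)).symm R, by simp [R]⟩
          have hmQ : W.HasMultiplicativeReductionAtPrime r := (W.hasMultiplicativeReductionAtPrime_iff_hasMultiplicativeReductionAt_holds R).mpr hm
          have hmQ' : W'.HasMultiplicativeReductionAtPrime r :=
            (W'.hasMultiplicativeReductionAtPrime_iff_hasMultiplicativeReductionAt_holds R).mpr (((hred R hr2).2.1).mpr hm)
          have hm_w : W.HasMultiplicativeReductionAt w := (hasMultiplicativeReductionAtPrime_primesEquiv_iff_holds W w r hw).mp hmQ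
          have hw2 : (primesEquiv w : ℕ) ≠ 2 := by rw [hw]; exact hr2
          have hwD : ¬ ((primesEquiv w : ℕ) : ℤ) ∣ t := by rw [hw]; exact hrD
          obtain ⟨-, -, key⟩ := AdditivePotMult.hasMultiplicativeReductionAt_and_split_iff_quadraticTwist_of_not_dvd W w hw2 hwD hm_w
          have hnsq : ¬ IsSquare ((t : ℤ) : ZMod (primesEquiv w : ℕ)) := by
            rw [hw]; exact ZMod.nonsquare_of_jacobiSym_eq_neg_one hj
          have e1 : W'.HasSplitMultiplicativeReductionAt w ↔ W'.HasSplitMultiplicativeReductionAtPrime r := by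
            rw [← W'.hasSplitMultiplicativeReductionAtPrime_iff_hasSplitMultiplicativeReductionAt w]; subst hw; rfl
          have e2 : W.HasSplitMultiplicativeReductionAt w ↔ W.HasSplitMultiplicativeReductionAtPrime r := by
            rw [← W.hasSplitMultiplicativeReductionAtPrime_iff_hasSplitMultiplicativeReductionAt w]; subst hw; rfl
          rw [hW'] at e1
          rw [e1, e2] at key
          have hflip : (W.quadraticTwist (t : ℚ)).HasSplitMultiplicativeReductionAtPrime r ↔ ¬ W.HasSplitMultiplicativeReductionAtPrime r := by
            rw [key]; constructor
            · intro h hs; exact hnsq (h.mpr hs)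
            · intro h; exact ⟨fun hsq ↦ absurd hsq hnsq, fun hs ↦ absurd hs h⟩
          rw [localRootNumberAt_primesEquiv_symm_eq, localRootNumberAt_primesEquiv_symm_eq, hj]
          by_cases hs : W.HasSplitMultiplicativeReductionAtPrime r
          · have hns' : ¬ W'.HasSplitMultiplicativeReductionAtPrime r := by rw [hW']; exact fun h ↦ (hflip.mp h) hs
            rw [localRootNumber_of_hasMultiplicativeReduction _ _ hmQ' hns', localRootNumber_of_hasSplitMultiplicativeReduction _ _ hs]
            push_cast; ring
          · have hs' : W'.HasSplitMultiplicativeReductionAtPrime r := by rw [hW']; exact hflip.mpr hs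
            rw [localRootNumber_of_hasSplitMultiplicativeReduction _ _ hs', localRootNumber_of_hasMultiplicativeReduction _ _ hmQ hs]
            push_cast; ring
    · -- additive: the level keeps `r` to an exponent `≥ 2`, so the engine's factor is `1`
      have hfac2 : N.factorization r ≠ 1 := by
        rw [show N.factorization r = N.factorization R from rfl, factorization_conductorNorm_primesEquiv_symm W R]
        have := (two_le_conductorExponent_iff_holds ((primesEquiv (R := ℤ)).symm R) W).mpr ha; omega
      have hsemi := htt R hr2 ha
      have ha' : W'.HasAdditiveReductionAt ((primesEquiv (R := ℤ)).symm R) := ((hred R hr2).2.2).mpr ha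
      have hsemi' := httW' R hr2 ha'
      rw [W'.atkinLehnerEigenvalueAt_eq_χ₄_of_twist_of_le hmod hf' R hr2 ha' hsemi'
          (TwistTypeConductor.conductorExponent_eq_two_of_twistType_odd W' R hr2 ha' (fun _ ↦ hsemi')) (hle' R hr2),
        W.atkinLehnerEigenvalueAt_eq_χ₄_of_twist_of_le hmod hf R hr2 ha hsemi
          (TwistTypeConductor.conductorExponent_eq_two_of_twistType_odd W R hr2 ha (fun _ ↦ hsemi)) (hle R hr2)]
      simp only [hjf, if_neg hfac2]
      push_cast; ring
  -- the products
  have hP : ∏ r ∈ N.primeFactors.erase 2, atkinLehnerEigenvalueAt f' r =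
      (∏ r ∈ N.primeFactors.erase 2, (jf r : ℂ)) * ∏ r ∈ N.primeFactors.erase 2, atkinLehnerEigenvalueAt f r := by
    rw [Finset.prod_congr rfl hlam_eq, Finset.prod_mul_distrib]
  set s₂ : ℤ := if W.HasSplitMultiplicativeReductionAtPrime 2 then -1 else 1 with hs₂
  have hs₂sq : (s₂ : ℂ) * (s₂ : ℂ) = 1 := by rw [hs₂]; split_ifs <;> norm_num
  have hεeq : frickeEigenvalue f' =
      ((if t = 2 then 1 else -1 : ℤ) : ℂ) * (s₂ : ℂ) * (∏ r ∈ N.primeFactors.erase 2, (jf r : ℂ)) * frickeEigenvalue f := by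
    rw [hε', hε, hpf, ← Finset.mul_prod_erase _ _ h2mem, ← Finset.mul_prod_erase N.primeFactors _ h2mem, hlam2', hlam2, hP]
    have e1 : ((if t = 2 then (1 : ℂ) else -1)) = ((if t = 2 then 1 else -1 : ℤ) : ℂ) := by split_ifs <;> simp
    rw [e1]
    linear_combination (-(((if t = 2 then 1 else -1 : ℤ) : ℂ) * (∏ r ∈ N.primeFactors.erase 2, (jf r : ℂ)) *
        ∏ r ∈ N.primeFactors.erase 2, atkinLehnerEigenvalueAt f r)) * hs₂sq
  have hw' := rootNumber_eq_neg_frickeEigenvalue (W := W') (fun _ _ ↦ IsNewform0.exists_functional_equation_holds)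
    (fun _ _ ↦ IsNewform0.frickeEigenvalue_eq_one_or_eq_neg_one_holds) hf'
  have hw := rootNumber_eq_neg_frickeEigenvalue (W := W) (fun _ _ ↦ IsNewform0.exists_functional_equation_holds)
    (fun _ _ ↦ IsNewform0.frickeEigenvalue_eq_one_or_eq_neg_one_holds) hf
  have hwf : frickeEigenvalue f = -((W.rootNumber : ℤ) : ℂ) := by rw [hw]; ring
  have h : ((W'.rootNumber : ℤ) : ℂ) =
      ((if t = 2 then 1 else -1 : ℤ) : ℂ) * ((s₂ : ℤ) : ℂ) * ((∏ r ∈ N.primeFactors.erase 2, jf r : ℤ) : ℂ) * ((W.rootNumber : ℤ) : ℂ) := by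
    rw [hw', hεeq, hwf]; push_cast; ring
  exact_mod_cast h

end Summit.BirchSwinnertonDyer.BirchSwinnertonDyer.Theorems.TwistRootNumberTwisted

end
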